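import Mathlib
import HarnessLib
import Summits.ValiantsHypothesis.ValiantsHypothesis.Theses.MonotoneRestoration
import Literature.Computability.AlgebraicComplexity.ArithCircuit
import Literature.Computability.AlgebraicComplexity.ArithCircuitProofs
import Literature.Computability.AlgebraicComplexity.MonotoneStructure
import Literature.Computability.AlgebraicComplexity.PermanentIrreducible
import Literature.ModelTheory.FiniteModelTheory.CkEquiv
import Summits.ValiantsHypothesis.ValiantsHypothesis.Theorems.MonotoneRestorationMonotoneRestorationQPCosetCount
import Summits.ValiantsHypothesis.ValiantsHypothesis.Theorems.MonotoneRestorationMonotoneRestorationQPSymmetricLB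
import Summits.ValiantsHypothesis.ValiantsHypothesis.Theorems.MonotoneRestorationMonotoneRestorationQPSupportSymmetrisation
import Summits.ValiantsHypothesis.ValiantsHypothesis.Theorems.MonotoneRestorationMonotoneRestorationQPSparseRegime
import Summits.ValiantsHypothesis.ValiantsHypothesis.Theorems.MonotoneRestorationMonotoneRestorationQPBeta
import Literature.Computability.AlgebraicComplexity.SymmetricArithCircuit
import Literature.Computability.AlgebraicComplexity.DawarWilsenach2025Proofs
import Literature.GroupTheory.PermutationGroups.SmallIndexSubgroups
import Summits.ValiantsHypothesis.ValiantsHypothesis.Theorems.MonotoneRestorationQP.Negative.LoadBearing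
import Summits.ValiantsHypothesis.ValiantsHypothesis.Theorems.MonotoneRestorationMonotoneRestorationQPPermSupportCount

/-! TTRL-lite variant V20078 of stmt-ValiantsHypothesis-15886 -/

-- `Summit.ValiantsHypothesis.ValiantsHypothesis.…` is the tree's mandated single-conjunct layout
-- (Sub = Summit), so the duplicated namespace component is intended.
set_option linter.dupNamespace false

namespace Summit.ValiantsHypothesis.ValiantsHypothesis.Theorems

open Summit.ValiantsHypothesis.ValiantsHypothesis.Theses.MonotoneRestoration
open Literature.Computability.AlgebraicComplexity

/-- A row-multilinear monomial `μ` (every row degree `≤ 1`) all of whose nonzero rows lie in `X`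
has degree at most `|X|`: the degree is the sum of the row degrees (`degree_rowDegrees`), the sum
may be restricted to `X`, and each summand is `≤ 1`. [folklore] -/
theorem stub_symmetricMonotone_choose_le_card_var20078 :
    ∀ (n : ℕ) (μ : Fin n × Fin n →₀ ℕ) (X : Finset (Fin n)), (∀ i : Fin n, rowDegrees μ i ≤ 1) →
      (∀ i : Fin n, rowDegrees μ i ≠ 0 → i ∈ X) → μ.degree ≤ X.card := by
  intro n μ X h1 hX
  rw [← degree_rowDegrees, Finsupp.degree_eq_sum]
  calc ∑ i, rowDegrees μ i = ∑ i ∈ X, rowDegrees μ i := by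
        symm
        refine Finset.sum_subset (Finset.subset_univ X) ?_
        intro i _ hi
        by_contra h
        exact hi (hX i h)
    _ ≤ ∑ i ∈ X, 1 := Finset.sum_le_sum fun i _ => h1 i
    _ = X.card := by simp

end Summit.ValiantsHypothesis.ValiantsHypothesis.Theorems
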